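import Summits.BirchSwinnertonDyer.BirchSwinnertonDyer.Theorems.AdditiveKolyvaginRoadLevelBasics
import Summits.BirchSwinnertonDyer.BirchSwinnertonDyer.Theorems.KolyvaginRoadThreeMethod2Eigen
import HarnessLib

/-!
# Route `AdditiveKolyvaginRoad`, crux `KolyvaginPrimitiveAdditive` (item stmt-BirchSwinnertonDyer-20132):
# the eigen-decomposition of `τ`-stable pieces of `H¹(K, E[p])` for an ODD prime `p`, and the rank identity at the
# bottom level of the p-generic canonical spaces `SelQP`
# (cell `pub/bsd-wall`, lead prover `bsd-wall-akr-p1` g2; `--supports stmt-BirchSwinnertonDyer-20132`, helper;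
# p-generic port of zhang3-p1's `Theorems/KolyvaginRoadThreeMethod2Eigen.lean`, `3 ↦ p` odd)

The stubs P ∕ S2 of the registered skeleton of crux 20132 (v6) speak of `#Sel_p(E/K) = p^s` (the WHOLE `p`-Selmer
group), while W. Zhang's induction — stub A1 (landed) and the S2 re-line over `LevelKolyvaginSystemP`
(`AdditiveKolyvaginRoadLevelSystems`) — runs on the `ZMod p`-ranks of the two EIGEN-parts `SelQP W K p c n true`,
`SelQP W K p c n false` under complex conjugation `τ = conjAct W c p`. This file supplies the bridge for odd `p`:

* `finrank_eq_eigen_add_of_odd` — for an additive involution `τ` of `H¹(K, E[p])`, `p` odd, and a `τ`-stable finite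
  subgroup `T`: `dim_𝔽_p T = dim_𝔽_p (T ∩ ker(τ − 1)) + dim_𝔽_p (T ∩ ker(τ + 1))` (`x = u(x + τx) + u(x − τx)` with
  `2u ≡ 1 (mod p)`);
* `finrank_selmer_eq_finrank_selQP_add` — at the bottom level: `dim Sel_p(E/K) = dim SelQP ∅ ⁺ + dim SelQP ∅ ⁻` for `K`
  imaginary quadratic and `c` an involution of `K` (the Selmer group is `Aut(K/ℚ)`-stable: tree
  `conjAct_mem_selmerGroup`; akr-p1 g0's `levelSelmerSubgroupP_empty`); and its `Nat.card` forms
  `natCard_selmer_eq_pow_finrank_selQP_add`, `finrank_selQP_empty_add_eq_one_iff` (`#Sel_p(E/K) = p`, the bottom S).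

HONEST FRAMING. Linear algebra over `ZMod p` plus landed tree theorems; no named fact, no `sorry`, 0 defs; closes
nothing. [cite: WZhang2014, §5 (eigenspaces Sel^±)] [cite: GrossLMS1991, §5 (5.1) and §10]
-/

-- single-conjunct summit: `Summit.BirchSwinnertonDyer.BirchSwinnertonDyer.…` repeats the name by design
set_option linter.dupNamespace false

noncomputable section

open scoped Classical

namespace Summit.BirchSwinnertonDyer.BirchSwinnertonDyer.Theorems.AdditiveKoly

open WeierstrassCurve NumberField IsDedekindDomain
  Literature.NumberTheory.EllipticCurves Literature.NumberTheory.GaloisRepresentations Module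

variable (W : WeierstrassCurve ℚ) (K : Type) [Field K] [NumberField K] (p : ℕ)

/-! ## Eigen-decomposition of a `τ`-stable finite piece of `H¹(K, E[p])`, `p` odd -/

/-- Every class of `H¹(K, E[p])` is killed by `p`. [folklore] -/
theorem prime_smul_eq_zero (x : Vp W K p) : (p : ℤ) • x = 0 := by
  have h := zsmul_galH1Torsion_eq_zero (W.baseChange K) ((p ^ 1 : ℕ) : ℤ) x
  have e : (p : ℤ) = ((p ^ 1 : ℕ) : ℤ) := by simp
  calc (p : ℤ) • x = ((p ^ 1 : ℕ) : ℤ) • x := by rw [e]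
    _ = 0 := h

/-- On `H¹(K, E[p])` with `p` odd, `2` is invertible: `(2u) • x = x` for `u = −(p − 1)/2`. [folklore] -/
theorem exists_two_mul_zsmul_eq_of_odd (hp : Odd p) : ∃ u : ℤ, ∀ x : Vp W K p, (2 * u) • x = x := by
  obtain ⟨k, hk⟩ := hp
  refine ⟨-(k : ℤ), fun x ↦ ?_⟩
  have h1 : (2 * -(k : ℤ)) = 1 - (p : ℤ) := by rw [hk]; push_cast; ring
  rw [h1, sub_zsmul, one_zsmul, prime_smul_eq_zero]
  simp

/-- **Eigen-decomposition in odd characteristic.** Let `τ` be an additive involution of `H¹(K, E[p])`, `p` an odd prime,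
and `T` a finite `τ`-stable subgroup. Then, as `ZMod p`-spaces, `dim T = dim (ker(τ − 1) ⊓ T) + dim (ker(τ + 1) ⊓ T)`:
the two eigen-parts meet in `0` (`x = −x ⇒ 2x = 0 ⇒ x = 0`) and span `T` (`x = u(x + τx) + u(x − τx)`, `2u ≡ 1`).
Port of zhang3-p1's `finrank_eq_eigen_add`. [folklore] -/
theorem finrank_eq_eigen_add_of_odd [Fact p.Prime] [Module (ZMod p) (Vp W K p)] (hp2 : p ≠ 2)
    (τ : Vp W K p →+ Vp W K p) (hτ : ∀ x, τ (τ x) = x)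
    (T : AddSubgroup (Vp W K p)) (hT : ∀ x ∈ T, τ x ∈ T) [Finite T] :
    finrank (ZMod p) (AddSubgroup.toZModSubmodule p T) =
      finrank (ZMod p) (AddSubgroup.toZModSubmodule p ((τ - (1 : ℤ) • AddMonoidHom.id _).ker ⊓ T)) +
        finrank (ZMod p) (AddSubgroup.toZModSubmodule p ((τ - (-1 : ℤ) • AddMonoidHom.id _).ker ⊓ T)) := by
  have hp : p.Prime := Fact.out
  obtain ⟨u, hu⟩ := exists_two_mul_zsmul_eq_of_odd W K p (hp.odd_of_ne_two hp2)
  set A : Submodule (ZMod p) (Vp W K p) :=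
    AddSubgroup.toZModSubmodule p ((τ - (1 : ℤ) • AddMonoidHom.id _).ker ⊓ T) with hA
  set B : Submodule (ZMod p) (Vp W K p) :=
    AddSubgroup.toZModSubmodule p ((τ - (-1 : ℤ) • AddMonoidHom.id _).ker ⊓ T) with hB
  set T' : Submodule (ZMod p) (Vp W K p) := AddSubgroup.toZModSubmodule p T with hT'
  -- membership unfoldings
  have memA : ∀ x, x ∈ A ↔ τ x = x ∧ x ∈ T := fun x ↦ by
    change x ∈ ((AddSubgroup.toZModSubmodule p _ : Submodule (ZMod p) (Vp W K p)) : Set (Vp W K p)) ↔ _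
    rw [AddSubgroup.coe_toZModSubmodule]
    simp only [AddSubgroup.coe_inf, Set.mem_inter_iff, SetLike.mem_coe, AddMonoidHom.mem_ker,
      AddMonoidHom.sub_apply, sub_eq_zero, one_smul]
    exact Iff.rfl
  have memB : ∀ x, x ∈ B ↔ τ x = -x ∧ x ∈ T := fun x ↦ by
    change x ∈ ((AddSubgroup.toZModSubmodule p _ : Submodule (ZMod p) (Vp W K p)) : Set (Vp W K p)) ↔ _
    rw [AddSubgroup.coe_toZModSubmodule]
    simp only [AddSubgroup.coe_inf, Set.mem_inter_iff, SetLike.mem_coe, AddMonoidHom.mem_ker,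
      AddMonoidHom.sub_apply, sub_eq_zero, neg_smul, one_smul]
    exact Iff.rfl
  have memT : ∀ x, x ∈ T' ↔ x ∈ T := fun x ↦ by
    change x ∈ ((AddSubgroup.toZModSubmodule p _ : Submodule (ZMod p) (Vp W K p)) : Set (Vp W K p)) ↔ _
    rw [AddSubgroup.coe_toZModSubmodule]
    rfl
  haveI : Finite T' := by
    refine Finite.of_injective (fun x : T' ↦ (⟨x.1, (memT x.1).mp x.2⟩ : T)) ?_
    intro x y h
    exact Subtype.ext (by simpa using congrArg Subtype.val h)
  haveI : Module.Finite (ZMod p) T' := Module.Finite.of_finite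
  have hAT : A ≤ T' := fun x hx ↦ (memT x).mpr ((memA x).mp hx).2
  have hBT : B ≤ T' := fun x hx ↦ (memT x).mpr ((memB x).mp hx).2
  haveI : Module.Finite (ZMod p) A := Submodule.finiteDimensional_of_le hAT
  haveI : Module.Finite (ZMod p) B := Submodule.finiteDimensional_of_le hBT
  -- A ⊓ B = ⊥
  have hinf : A ⊓ B = ⊥ := by
    rw [eq_bot_iff]
    intro x hx
    obtain ⟨hxA, hxB⟩ := Submodule.mem_inf.mp hx
    have h1 := ((memA x).mp hxA).1
    have h2 := ((memB x).mp hxB).1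
    rw [h1] at h2
    -- x = -x and 2 invertible ⇒ x = 0
    have hx2 : (2 : ℤ) • x = 0 := by rw [two_zsmul]; nth_rw 2 [h2]; exact add_neg_cancel x
    have : x = u • ((2 : ℤ) • x) := by rw [smul_smul, mul_comm, hu x]
    rw [Submodule.mem_bot, this, hx2, zsmul_zero]
  -- A ⊔ B = T'
  have hsup : A ⊔ B = T' := by
    refine le_antisymm (sup_le hAT hBT) fun x hx ↦ ?_
    have hxT : x ∈ T := (memT x).mp hx
    -- x = u (x + τ x) + u (x − τ x)
    have hplus : u • (x + τ x) ∈ A := by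
      refine (memA _).mpr ⟨?_, T.zsmul_mem (T.add_mem hxT (hT x hxT)) u⟩
      rw [map_zsmul, map_add, hτ, add_comm]
    have hminus : u • (x - τ x) ∈ B := by
      refine (memB _).mpr ⟨?_, T.zsmul_mem (T.sub_mem hxT (hT x hxT)) u⟩
      rw [map_zsmul, map_sub, hτ, ← neg_sub x (τ x), zsmul_neg]
    have hdec : x = u • (x + τ x) + u • (x - τ x) := by
      have : u • (x + τ x) + u • (x - τ x) = (2 * u) • x := by
        rw [← zsmul_add, show x + τ x + (x - τ x) = x + x by abel, ← two_zsmul, smul_smul, mul_comm]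
      rw [this, hu x]
    rw [hdec]
    exact Submodule.add_mem_sup hplus hminus
  have h := Submodule.finrank_sup_add_finrank_inf_eq A B
  rw [hinf, finrank_bot, add_zero, hsup] at h
  exact h

/-! ## The bottom level: `dim Sel_p(E/K) = dim SelQP_∅⁺ + dim SelQP_∅⁻` -/

variable [W.IsGloballyMinimal]

/-- `SelQP W K p c ∅ μ` is `ker(τ − sgn μ) ⊓ Sel_p(E/K)` read as a `ZMod p`-subspace (akr-p1 g0's
`levelSelmerSubgroupP_empty`). [folklore] -/
theorem selQP_empty_eq [Module (ZMod p) (Vp W K p)] (c : K ≃ₐ[ℚ] K) (μ : Bool) :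
    SelQP W K p c ∅ μ = AddSubgroup.toZModSubmodule p
      ((conjAct W c ((p ^ 1 : ℕ) : ℤ) - sgnP μ • AddMonoidHom.id (Vp W K p)).ker ⊓
        selmerGroup (W.baseChange K) ((p ^ 1 : ℕ) : ℤ)) := by
  unfold SelQP
  rw [Finset.image_empty, levelSelmerSubgroupP_empty]

/-- **`dim_𝔽_p Sel_p(E/K) = dim SelQP ∅ ⁺ + dim SelQP ∅ ⁻`** for `p` an odd prime, `K` imaginary quadratic and `c` an
involution of `K` (e.g. complex conjugation): the Selmer group is `Aut(K/ℚ)`-stable (tree `conjAct_mem_selmerGroup`),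
finite (tree `finite_selmerGroup_holds`), and decomposes into its `τ`-eigenspaces since `p` is odd. The dictionary
between the stubs' eigen-ranks at level `∅` and every tree statement about `#Sel_p(E/K)`.
[cite: GrossLMS1991, §5 (5.1) and §10] [cite: WZhang2014, §5] -/
theorem finrank_selmer_eq_finrank_selQP_add [W.IsElliptic] [Fact p.Prime] [Module (ZMod p) (Vp W K p)] (hp2 : p ≠ 2)
    (hK : IsImaginaryQuadratic K) (c : K ≃ₐ[ℚ] K) (hc : c * c = 1) :
    finrank (ZMod p) (AddSubgroup.toZModSubmodule p (selmerGroup (W.baseChange K) ((p ^ 1 : ℕ) : ℤ))) =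
      finrank (ZMod p) (SelQP W K p c ∅ true) + finrank (ZMod p) (SelQP W K p c ∅ false) := by
  have hp : p.Prime := Fact.out
  have hNp : (((p ^ 1 : ℕ) : ℤ)) ≠ 0 := by exact_mod_cast pow_ne_zero 1 hp.ne_zero
  haveI : Finite (selmerGroup (W.baseChange K) ((p ^ 1 : ℕ) : ℤ)) :=
    (W.baseChange K).finite_selmerGroup_holds hNp
  have hstab : ∀ x ∈ selmerGroup (W.baseChange K) ((p ^ 1 : ℕ) : ℤ),
      conjAct W c ((p ^ 1 : ℕ) : ℤ) x ∈ selmerGroup (W.baseChange K) ((p ^ 1 : ℕ) : ℤ) :=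
    fun x hx ↦ conjAct_mem_selmerGroup W (fun w ↦ hK.2.isComplex w) c _ hx
  have h := finrank_eq_eigen_add_of_odd W K p hp2 (conjAct W c ((p ^ 1 : ℕ) : ℤ))
    (conjAct_conjAct_of_mul_self W hc ((p ^ 1 : ℕ) : ℤ)) _ hstab
  rw [selQP_empty_eq, selQP_empty_eq]
  have ht : sgnP true = 1 := rfl
  have hf : sgnP false = -1 := rfl
  rw [ht, hf]
  exact h

/-- **`#Sel_p(E/K) = p ^ (dim SelQP ∅ ⁺ + dim SelQP ∅ ⁻)`** — the cardinality form of
`finrank_selmer_eq_finrank_selQP_add`, matching the `Nat.card`-currency of the skeleton's stubs P ∕ S2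
(`Nat.card (selmerGroup …) = p ^ s`). [cite: GrossLMS1991, §10] -/
theorem natCard_selmer_eq_pow_finrank_selQP_add [W.IsElliptic] [Fact p.Prime] [Module (ZMod p) (Vp W K p)]
    (hp2 : p ≠ 2) (hK : IsImaginaryQuadratic K) (c : K ≃ₐ[ℚ] K) (hc : c * c = 1) :
    Nat.card (selmerGroup (W.baseChange K) ((p ^ 1 : ℕ) : ℤ)) =
      p ^ (finrank (ZMod p) (SelQP W K p c ∅ true) + finrank (ZMod p) (SelQP W K p c ∅ false)) := by
  rw [← finrank_selmer_eq_finrank_selQP_add W K p hp2 hK c hc]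
  have hp : p.Prime := Fact.out
  have hNp : (((p ^ 1 : ℕ) : ℤ)) ≠ 0 := by exact_mod_cast pow_ne_zero 1 hp.ne_zero
  haveI : Finite (selmerGroup (W.baseChange K) ((p ^ 1 : ℕ) : ℤ)) :=
    (W.baseChange K).finite_selmerGroup_holds hNp
  haveI : Finite (AddSubgroup.toZModSubmodule p (selmerGroup (W.baseChange K) ((p ^ 1 : ℕ) : ℤ))) :=
    Finite.of_equiv _ (Equiv.setCongr (AddSubgroup.coe_toZModSubmodule p _).symm)
  rw [pow_finrank_eq_natCard]
  exact Nat.card_congr (Equiv.setCongr (AddSubgroup.coe_toZModSubmodule p _)).symm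

/-- **The bottom case in `Nat.card` currency**: `dim SelQP ∅ ⁺ + dim SelQP ∅ ⁻ = 1 ↔ #Sel_p(E/K) = p` (the case
`s = 1` of stub P, served by the bottom rung S ∘ A ∘ B of the skeleton). [cite: GrossLMS1991, §10 (Prop. 2.3)] -/
theorem finrank_selQP_empty_add_eq_one_iff [W.IsElliptic] [Fact p.Prime] [Module (ZMod p) (Vp W K p)]
    (hp2 : p ≠ 2) (hK : IsImaginaryQuadratic K) (c : K ≃ₐ[ℚ] K) (hc : c * c = 1) :
    finrank (ZMod p) (SelQP W K p c ∅ true) + finrank (ZMod p) (SelQP W K p c ∅ false) = 1 ↔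
      Nat.card (selmerGroup (W.baseChange K) ((p ^ 1 : ℕ) : ℤ)) = p := by
  have hp : p.Prime := Fact.out
  rw [natCard_selmer_eq_pow_finrank_selQP_add W K p hp2 hK c hc]
  constructor
  · intro h
    rw [h, pow_one]
  · intro h
    have h' : p ^ (finrank (ZMod p) (SelQP W K p c ∅ true) + finrank (ZMod p) (SelQP W K p c ∅ false)) = p ^ 1 := by
      rw [h, pow_one]
    exact Nat.pow_right_injective hp.two_le h'

end Summit.BirchSwinnertonDyer.BirchSwinnertonDyer.Theorems.AdditiveKoly

end
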